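import Mathlib
import HarnessLib
import Summits.Ventures.LatticeQCDFlow.Exactness.LipschitzDilationMinorisation

/-!
# A Lipschitz-small perturbation of a dilation ON A BALL covers a ball, and additive Haar measure there is dominated by the measure of preimages

HONEST FRAMING: exact (Metropolis-corrected) sampling algorithms for lattice gauge theory;
figures of merit are autocorrelation/cost numbers at stated couplings and volumes; no
continuum-physics claim.

Venture `LatticeQCDFlow` (cell pub-lqcd), topic `Exactness`, FANOUT row 9 (eng-latcore; the
measure-theoretic half of the multi-step `SU(N)` leapfrog HMC argument — `KickedProductTwoPoint.lean`
is the analytic half).  NEW WORK of the cell over Mathlib (`ApproximatesLinearOn.surjOn_closedBall_of_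
nonlinearRightInverse` — the quantitative surjectivity step of the Lipschitz inverse function theorem;
`ContinuousLinearEquiv.isAddHaarMeasure_map` + `Measure.isAddLeftInvariant_eq_smul` — uniqueness of Haar
measure) and the tree (`LipschitzDilationMinorisation.volume_image_le_of_lipschitzOnWith`, row 14:
Lebesgue measure of a Lipschitz image on `ι → ℝ`); nothing here is cited as a fact.  Printed
counterpart, NAMED ONLY: the Lipschitz inverse function theorem (Hadamard).

THE POINT.  `ApproxDilationPushforward.lean` (row 9, gen-17) needs the estimate
`‖Ψ p − Ψ p' − τ•(p − p')‖ ≤ c‖p − p'‖` for ALL `p, p'` of `ι → ℝ`.  Through the exponential chart of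
`SU(N)` the estimate only holds on a ball, and the momentum coordinate space is any finite-dimensional
`V`.  This file is the local version, for an arbitrary finite-dimensional real normed space `V` with an
additive Haar measure `μ`, stated in PREIMAGE form (no measurability of `Ψ` needed):

* §1 **`exists_addHaar_image_le_of_lipschitzOnWith`** — there is `A = A(V)` with
  `μ (f '' s) ≤ (A·K)^{dim V} · μ s` for every `f` `K`-Lipschitz on `s` (transport to `ℝ^{dim V}` by a
  linear isomorphism, Haar uniqueness, and the Hausdorff-measure bound there).
* §2 **`surjOn_closedBall_of_approxOn`** — if `‖Ψ p − Ψ p' − τ•(p − p')‖ ≤ c‖p − p'‖` on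
  `closedBall 0 R` with `0 ≤ c < τ`, then `closedBall (Ψ 0) ((τ − c)R) ⊆ Ψ '' closedBall 0 R`;
  `lipschitzOnWith_of_approxOn` (`Ψ` is `(τ + c)`-Lipschitz there).
* §3 **`addHaar_inter_ball_le_of_approxOn`** — consequently, if `r + ‖Ψ 0‖ ≤ (τ − c)R`, for EVERY set
  `B`: `μ (B ∩ ball 0 r) ≤ (A(τ + c))^{dim V} · μ (Ψ⁻¹ B ∩ closedBall 0 R)` — additive Haar measure on the
  small ball is dominated by the measure of the momenta in the big ball that `Ψ` sends into the set.

NOT CLAIMED: any value of `A` (it depends on the chosen linear isomorphism); the sharp Jacobian;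
anything for `c ≥ τ`.
-/

noncomputable section

namespace Summit.Ventures.LatticeQCDFlow.Exactness

open MeasureTheory Measure Set Metric Function
open scoped ENNReal NNReal

variable {V : Type*} [NormedAddCommGroup V] [NormedSpace ℝ V] [FiniteDimensional ℝ V]
  [MeasurableSpace V] [BorelSpace V] (μ : Measure V) [IsAddHaarMeasure μ]

/-! ## §1 Additive Haar measure of a Lipschitz image -/

/-- **LIPSCHITZ MAPS INFLATE ADDITIVE HAAR MEASURE BY AT MOST `(A·K)^{dim V}`**: there is a constant
`A` (of `V`) such that `μ (f '' s) ≤ (A K)^{dim V} μ s` whenever `f` is `K`-Lipschitz on `s`. -/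
theorem exists_addHaar_image_le_of_lipschitzOnWith :
    ∃ A : ℝ≥0, ∀ (K : ℝ≥0) (f : V → V) (s : Set V), LipschitzOnWith K f s →
      μ (f '' s) ≤ ((A * K : ℝ≥0) : ℝ≥0∞) ^ Module.finrank ℝ V * μ s := by
  set d := Module.finrank ℝ V with hd
  -- coordinates
  let T : V ≃L[ℝ] (Fin d → ℝ) := ContinuousLinearEquiv.ofFinrankEq (by rw [Module.finrank_fin_fun])
  let e : V ≃ᵐ (Fin d → ℝ) := T.toHomeomorph.toMeasurableEquiv
  have he : (e : V → Fin d → ℝ) = T := rfl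
  -- the transported measure is a multiple of Lebesgue measure
  set ν : Measure (Fin d → ℝ) := μ.map T with hν
  haveI : IsAddHaarMeasure ν := ContinuousLinearEquiv.isAddHaarMeasure_map T μ
  have hνvol : ν = ν.addHaarScalarFactor volume • volume := isAddLeftInvariant_eq_smul ν volume
  have hμν : ∀ X : Set V, μ X = ν (T '' X) := fun X => by
    rw [hν, ← he, MeasurableEquiv.map_apply, Set.preimage_image_eq _ e.injective]
  set a : ℝ≥0 := ‖(T : V →L[ℝ] (Fin d → ℝ))‖₊ with ha
  set a' : ℝ≥0 := ‖(T.symm : (Fin d → ℝ) →L[ℝ] V)‖₊ with ha'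
  refine ⟨a * a', fun K f s hf => ?_⟩
  -- the transported map is Lipschitz on the transported set
  set g : (Fin d → ℝ) → Fin d → ℝ := T ∘ f ∘ T.symm with hg
  have hmaps : MapsTo (T.symm : (Fin d → ℝ) → V) (T '' s) s := by
    rintro _ ⟨x, hx, rfl⟩; simpa using hx
  have hg_lip : LipschitzOnWith (a * (K * a')) g (T '' s) := by
    have h1 : LipschitzOnWith (K * a') (f ∘ T.symm) (T '' s) :=
      hf.comp ((T.symm : (Fin d → ℝ) →L[ℝ] V).lipschitz.lipschitzOnWith) hmaps
    exact (T : V →L[ℝ] (Fin d → ℝ)).lipschitz.comp_lipschitzOnWith h1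
  have himage : T '' (f '' s) = g '' (T '' s) := by
    rw [hg, image_image, image_image]
    refine image_congr fun x hx => ?_
    simp
  have hvol := volume_image_le_of_lipschitzOnWith hg_lip
  rw [Fintype.card_fin] at hvol
  -- assemble
  rw [hμν (f '' s), hμν s, himage, hνvol, Measure.smul_apply, Measure.smul_apply, ENNReal.smul_def, ENNReal.smul_def]
  calc (ν.addHaarScalarFactor volume : ℝ≥0∞) * volume (g '' (T '' s))
      ≤ (ν.addHaarScalarFactor volume : ℝ≥0∞) * (((a * (K * a') : ℝ≥0) : ℝ≥0∞) ^ d * volume (T '' s)) := by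
        gcongr
    _ = ((a * a' * K : ℝ≥0) : ℝ≥0∞) ^ d * ((ν.addHaarScalarFactor volume : ℝ≥0∞) * volume (T '' s)) := by
        push_cast
        ring

/-! ## §2 An approximate dilation on a closed ball covers a ball -/

section Approx

variable {Ψ : V → V} {τ c R : ℝ}

omit [FiniteDimensional ℝ V] [MeasurableSpace V] [BorelSpace V] in
/-- `Ψ` is `(τ + c)`-Lipschitz on the ball (`τ ≥ 0`). -/
theorem norm_sub_le_of_approxOn (hτ : 0 ≤ τ)
    (h : ∀ p ∈ closedBall (0 : V) R, ∀ p' ∈ closedBall (0 : V) R, ‖Ψ p - Ψ p' - τ • (p - p')‖ ≤ c * ‖p - p'‖)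
    {p p' : V} (hp : p ∈ closedBall (0 : V) R) (hp' : p' ∈ closedBall (0 : V) R) :
    ‖Ψ p - Ψ p'‖ ≤ (τ + c) * ‖p - p'‖ := by
  calc ‖Ψ p - Ψ p'‖ = ‖(Ψ p - Ψ p' - τ • (p - p')) + τ • (p - p')‖ := by rw [sub_add_cancel]
    _ ≤ ‖Ψ p - Ψ p' - τ • (p - p')‖ + ‖τ • (p - p')‖ := norm_add_le _ _
    _ ≤ c * ‖p - p'‖ + τ * ‖p - p'‖ := by
        rw [norm_smul, Real.norm_of_nonneg hτ]; exact add_le_add (h p hp p' hp') le_rfl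
    _ = (τ + c) * ‖p - p'‖ := by ring

omit [FiniteDimensional ℝ V] [MeasurableSpace V] [BorelSpace V] in
/-- `Ψ` is `(τ + c)`-Lipschitz on the closed ball (`τ, c ≥ 0`). -/
theorem lipschitzOnWith_of_approxOn (hτ : 0 ≤ τ) (hc : 0 ≤ c)
    (h : ∀ p ∈ closedBall (0 : V) R, ∀ p' ∈ closedBall (0 : V) R, ‖Ψ p - Ψ p' - τ • (p - p')‖ ≤ c * ‖p - p'‖) :
    LipschitzOnWith (Real.toNNReal (τ + c)) Ψ (closedBall (0 : V) R) :=
  LipschitzOnWith.of_dist_le_mul fun p hp p' hp' => by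
    rw [dist_eq_norm, dist_eq_norm, Real.coe_toNNReal _ (add_nonneg hτ hc)]
    exact norm_sub_le_of_approxOn hτ h hp hp'

omit [FiniteDimensional ℝ V] [MeasurableSpace V] [BorelSpace V] in
/-- Lower bound: `(τ − c)‖p − p'‖ ≤ ‖Ψ p − Ψ p'‖` on the ball (`τ ≥ 0`). -/
theorem le_norm_sub_of_approxOn (hτ : 0 ≤ τ)
    (h : ∀ p ∈ closedBall (0 : V) R, ∀ p' ∈ closedBall (0 : V) R, ‖Ψ p - Ψ p' - τ • (p - p')‖ ≤ c * ‖p - p'‖)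
    {p p' : V} (hp : p ∈ closedBall (0 : V) R) (hp' : p' ∈ closedBall (0 : V) R) :
    (τ - c) * ‖p - p'‖ ≤ ‖Ψ p - Ψ p'‖ := by
  have htri : ‖τ • (p - p')‖ ≤ ‖Ψ p - Ψ p'‖ + ‖Ψ p - Ψ p' - τ • (p - p')‖ := by
    calc ‖τ • (p - p')‖ = ‖(Ψ p - Ψ p') - (Ψ p - Ψ p' - τ • (p - p'))‖ := by rw [sub_sub_cancel]
      _ ≤ _ := norm_sub_le _ _
  rw [norm_smul, Real.norm_of_nonneg hτ] at htri
  have := h p hp p' hp'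
  nlinarith

omit [MeasurableSpace V] [BorelSpace V] in
/-- **AN APPROXIMATE DILATION ON A CLOSED BALL COVERS THE BALL OF RADIUS `(τ − c)R` ABOUT `Ψ 0`**
(`0 ≤ c < τ`, `R ≥ 0`): the quantitative surjectivity step of the Lipschitz inverse function theorem. -/
theorem surjOn_closedBall_of_approxOn (hcτ : c < τ) (hc : 0 ≤ c) (hR : 0 ≤ R)
    (h : ∀ p ∈ closedBall (0 : V) R, ∀ p' ∈ closedBall (0 : V) R, ‖Ψ p - Ψ p' - τ • (p - p')‖ ≤ c * ‖p - p'‖) :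
    closedBall (Ψ 0) ((τ - c) * R) ⊆ Ψ '' closedBall (0 : V) R := by
  have hτ : 0 < τ := hc.trans_lt hcτ
  have happ : ApproximatesLinearOn Ψ (τ • ContinuousLinearMap.id ℝ V) (closedBall (0 : V) R) ⟨c, hc⟩ := by
    intro p hp p' hp'
    change ‖Ψ p - Ψ p' - τ • (p - p')‖ ≤ c * ‖p - p'‖
    exact h p hp p' hp'
  -- the right inverse `y ↦ τ⁻¹ • y` of the dilation, with bound `τ⁻¹`
  let ri : ContinuousLinearMap.NonlinearRightInverse (τ • ContinuousLinearMap.id ℝ V) :=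
    { toFun := fun y => τ⁻¹ • y
      nnnorm := Real.toNNReal τ⁻¹
      bound' := fun y => by
        rw [norm_smul, Real.norm_of_nonneg (inv_nonneg.2 hτ.le), Real.coe_toNNReal _ (inv_nonneg.2 hτ.le)]
      right_inv' := fun y => by
        change τ • (τ⁻¹ • y) = y
        rw [smul_smul, mul_inv_cancel₀ hτ.ne', one_smul] }
  have hsurj := happ.surjOn_closedBall_of_nonlinearRightInverse ri hR Subset.rfl
  have hnn : (ri.nnnorm : ℝ)⁻¹ = τ := by
    change ((Real.toNNReal τ⁻¹ : ℝ≥0) : ℝ)⁻¹ = τ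
    rw [Real.coe_toNNReal _ (inv_nonneg.2 hτ.le), inv_inv]
  rw [hnn] at hsurj
  intro y hy
  exact hsurj hy

end Approx

/-! ## §3 The domination in preimage form -/

omit [BorelSpace V] [μ.IsAddHaarMeasure] in
/-- **ADDITIVE HAAR MEASURE ON THE SMALL BALL IS DOMINATED BY THE MEASURE OF PREIMAGES IN THE BIG
BALL.**  Let `A` satisfy §1.  If `‖Ψ p − Ψ p' − τ•(p − p')‖ ≤ c‖p − p'‖` on `closedBall 0 R`,
`0 ≤ c < τ`, `R ≥ 0` and `r + ‖Ψ 0‖ ≤ (τ − c)R`, then for EVERY set `B`,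
`μ (B ∩ ball 0 r) ≤ (A(τ + c))^{dim V} · μ (Ψ⁻¹ B ∩ closedBall 0 R)`. -/
theorem addHaar_inter_ball_le_of_approxOn {A : ℝ≥0}
    (hA : ∀ (K : ℝ≥0) (f : V → V) (s : Set V), LipschitzOnWith K f s →
      μ (f '' s) ≤ ((A * K : ℝ≥0) : ℝ≥0∞) ^ Module.finrank ℝ V * μ s)
    {Ψ : V → V} {τ c R r : ℝ} (hcτ : c < τ) (hc : 0 ≤ c) (hR : 0 ≤ R)
    (h : ∀ p ∈ closedBall (0 : V) R, ∀ p' ∈ closedBall (0 : V) R, ‖Ψ p - Ψ p' - τ • (p - p')‖ ≤ c * ‖p - p'‖)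
    (hr : r + ‖Ψ 0‖ ≤ (τ - c) * R) (B : Set V) :
    μ (B ∩ ball 0 r) ≤ ((A * Real.toNNReal (τ + c) : ℝ≥0) : ℝ≥0∞) ^ Module.finrank ℝ V *
      μ (Ψ ⁻¹' B ∩ closedBall 0 R) := by
  have hτ : 0 < τ := hc.trans_lt hcτ
  -- the small ball lies inside the covered ball
  have hsub : B ∩ ball 0 r ⊆ Ψ '' closedBall (0 : V) R := by
    rintro y ⟨-, hy⟩
    refine surjOn_closedBall_of_approxOn hcτ hc hR h (mem_closedBall.2 ?_)
    rw [mem_ball_zero_iff] at hy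
    calc dist y (Ψ 0) = ‖y - Ψ 0‖ := dist_eq_norm _ _
      _ ≤ ‖y‖ + ‖Ψ 0‖ := norm_sub_le _ _
      _ ≤ (τ - c) * R := by linarith
  -- so it is the image of the momenta of the big ball that `Ψ` sends into it
  set S : Set V := Ψ ⁻¹' (B ∩ ball 0 r) ∩ closedBall 0 R with hS
  have himage : Ψ '' S = B ∩ ball 0 r := by
    rw [hS, image_preimage_inter, inter_eq_left.2 hsub]
  calc μ (B ∩ ball 0 r) = μ (Ψ '' S) := by rw [himage]
    _ ≤ ((A * Real.toNNReal (τ + c) : ℝ≥0) : ℝ≥0∞) ^ Module.finrank ℝ V * μ S :=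
        hA _ Ψ S ((lipschitzOnWith_of_approxOn hτ.le hc h).mono inter_subset_right)
    _ ≤ ((A * Real.toNNReal (τ + c) : ℝ≥0) : ℝ≥0∞) ^ Module.finrank ℝ V * μ (Ψ ⁻¹' B ∩ closedBall 0 R) := by
        gcongr
        exact inter_subset_inter_left _ (preimage_mono inter_subset_left)

end Summit.Ventures.LatticeQCDFlow.Exactness
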